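import Literature.Geometry.Kaehler.SiegelTorusThetaDivisor
import Literature.Geometry.Kaehler.ComplexTorusMaps
import Literature.Analysis.SpecialFunctions.RiemannThetaBlockDiagonal
import HarnessLib

/-!
# The theta divisor of a product: `Θ_{X₁ × X₂} = (Θ₁ × X₂) ∪ (X₁ × Θ₂)`

Layer `Literature/Geometry/Kaehler`, namespace `Literature.Geometry.Kaehler.ComplexTorus` (lane
`lit-hodgefound`, Layer A4, theta-divisor row, validation instance "products"; sequel of
`SiegelTorusThetaDivisor.lean` — `thetaDivisor Ω hΩ hpos Φ hΦ ⊂ X_Ω`, `cover_mem_thetaDivisor_iff` — and of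
`Literature/Analysis/SpecialFunctions/RiemannThetaBlockDiagonal.lean` — `ϑ(z, Ω₁ ⊕ Ω₂) = ϑ(z₁, Ω₁) ϑ(z₂, Ω₂)`;
the case of `1 × 1` blocks is `SiegelTorusThetaDivisorDiagonal.lean`).

Source. S. Grushevsky, Y. Xie, *Integrable systems approach to the Schottky problem and related
questions* (2025), Remark 6.2 (held text `paper:arxiv-2504.20243`, chunk p0034): "we explicitly exclude the
case of decomposable abelian varieties, that is products of lower dimensional abelian varieties. Indeed,
if `(A, Θ) = (A′, Θ′) × (A″, Θ″)`, then the theta divisor `Θ = (Θ′ × A″) ∪ (A′ × Θ″)` is reducible, the theta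
function is the product `θ(τ, z) = θ′(τ′, z′) · θ(τ″, z″)`, and the singular locus of the theta divisor
`Sing Θ` contains a `(g − 2)`-dimensional subvariety `Θ′ × Θ″`".

Setting. `Ω₁ ∈ ℌ_{n₁}`, `Ω₂ ∈ ℌ_{n₂}` and `Ω = Ω₁ ⊕ Ω₂ = (Ω₁ 0; 0 Ω₂) ∈ ℌ_{n₁+n₂}` (the hypothesis
`hΩb : Ω = Matrix.reindex finSumFinEquiv finSumFinEquiv (Matrix.fromBlocks Ω₁ 0 0 Ω₂)`; symmetric and with
`Im Ω ≻ 0` by `blockDiag_symm`, `posDef_im_blockDiag`), with the Siegel period isomorphisms `Φ`, `Φ₁`, `Φ₂`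
(`Φ(a, b) = a + Ωb`, hypotheses `hΦ`, `hΦ₁`, `hΦ₂`). The principally polarised Siegel torus `X_Ω` is the
product `X_{Ω₁} × X_{Ω₂}`: in the tree's lattice coordinates `ComplexTorus Φ = (ℝ/ℤ)^{2(n₁+n₂)}` the two
projections are the coordinate restrictions `x ↦ x|₁ = x ∘ Sum.map castAdd castAdd`,
`x ↦ x|₂ = x ∘ Sum.map natAdd natAdd`, i.e. the homomorphisms `mapMatrix Φ Φᵢ Pᵢ` of the `0/1` projection
matrices `P₁`, `P₂` (`ComplexTorusMaps.mapMatrix`, "the homomorphism of tori induced by an integer matrix").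

Contents (theorems only; no definition, no named fact, net debt `0`):

* `mapMatrix_submatrix_one` — `mapMatrix Φ Φ' (1.submatrix e id) x = x ∘ e`: coordinate restrictions are
  homomorphisms of tori;
* `apply_castAdd_eq`, `apply_natAdd_eq` — the period isomorphism splits, `Φ(a)|_{ℂ^{n₁}} = Φ₁(a|₁)`,
  `Φ(a)|_{ℂ^{n₂}} = Φ₂(a|₂)`; `cover_restrict_fst/snd` — the projections commute with the coverings;
* **`thetaDivisor_blockDiag_eq_union`** — `Θ = p₁⁻¹(Θ₁) ∪ p₂⁻¹(Θ₂) = (Θ₁ × X₂) ∪ (X₁ × Θ₂)` as subsets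
  of `X_Ω`; `preimage_fst_subset_thetaDivisor`, `preimage_snd_subset_thetaDivisor` (the two components);
* **`hasFDerivAt_riemannTheta_zero_of_mem_inter`** — on `p₁⁻¹(Θ₁) ∩ p₂⁻¹(Θ₂) = Θ₁ × Θ₂` the defining
  equation `ϑ(·, Ω)` of `Θ` on the universal cover vanishes together with its differential: "`Sing Θ`
  contains `Θ′ × Θ″`" (multiplicity `≥ 2`; the tree's `thetaDivisor` is the support, cf. the divisor notion
  of `SiegelTorusThetaDivisor.lean`).

Not here: the identification of `X_Ω` with the tree's abstract product torus
`ComplexTorus (prodPeriod Φ₁ Φ₂)` of `ComplexTorusProduct.lean` (a reindexing of lattice coordinates), and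
the irreducibility of `Θ` for indecomposable `(A, Θ)`.

## References

* [GrushevskyXie2025] S. Grushevsky, Y. Xie, *Integrable systems approach to the Schottky problem and
  related questions*, arXiv:2504.20243 (2025), Remark 6.2 (held text p0034).
* [Lange2023AbelianVarietiesComplex] H. Lange, *Abelian Varieties over the Complex Numbers* (2023),
  §2.1.1 (p0078), §2.1.2 (p0079) (`π^*Θ = (ϑ)`), §2.1.4 Exercise (7) (products of elliptic curves).
* [LangeBirkenhake1992] H. Lange, Ch. Birkenhake, *Complex Abelian Varieties* (1992), §1.1.2
  (homomorphisms and their rational representations).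
-/

noncomputable section

open scoped Manifold Topology
open Set Function Complex Matrix
open Literature.Analysis.SpecialFunctions

namespace Literature.Geometry.Kaehler

namespace ComplexTorus

/-! ### Coordinate restrictions are homomorphisms of tori -/

section Restrict

variable {ι ι' : Type*} [Fintype ι] [DecidableEq ι] {E E' : Type*} [NormedAddCommGroup E]
  [NormedSpace ℂ E] [NormedAddCommGroup E'] [NormedSpace ℂ E']
  (Φ : (ι → ℝ) ≃L[ℝ] E) (Φ' : (ι' → ℝ) ≃L[ℝ] E')

/-- **Coordinate restriction along `e : ι' → ι` is the homomorphism of the `0/1` matrix `(δ_{e(j), k})`**: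
`mapMatrix Φ Φ' (1.submatrix e id) x = x ∘ e` (e.g. the projections of a product torus onto its factors,
in lattice coordinates). [cite: LangeBirkenhake1992, §1.1.2] -/
theorem mapMatrix_submatrix_one (e : ι' → ι) (x : ComplexTorus Φ) :
    mapMatrix Φ Φ' ((1 : Matrix ι ι ℤ).submatrix e id) x = fun j ↦ x (e j) := by
  funext j
  change ∑ i, ((1 : Matrix ι ι ℤ).submatrix e id) j i • x i = x (e j)
  simp [Matrix.one_apply, ite_smul, Finset.sum_ite_eq]

end Restrict

/-! ### The product of two principally polarised Siegel tori -/

section Product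

variable {n₁ n₂ : ℕ} (Ω₁ : Matrix (Fin n₁) (Fin n₁) ℂ) (Ω₂ : Matrix (Fin n₂) (Fin n₂) ℂ)
  {Ω : Matrix (Fin (n₁ + n₂)) (Fin (n₁ + n₂)) ℂ}
  (hΩb : Ω = Matrix.reindex finSumFinEquiv finSumFinEquiv (Matrix.fromBlocks Ω₁ 0 0 Ω₂))
  (hΩ : ∀ i j, Ω i j = Ω j i) (hpos : (Matrix.of fun i j => (Ω i j).im).PosDef)
  (Φ : (Fin (n₁ + n₂) ⊕ Fin (n₁ + n₂) → ℝ) ≃L[ℝ] (Fin (n₁ + n₂) → ℂ))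
  (hΦ : ∀ v i, Φ v i = (v (Sum.inl i) : ℂ) + ∑ j, Ω i j * (v (Sum.inr j) : ℂ))
  (hΩ₁ : ∀ i j, Ω₁ i j = Ω₁ j i) (hpos₁ : (Matrix.of fun i j => (Ω₁ i j).im).PosDef)
  (Φ₁ : (Fin n₁ ⊕ Fin n₁ → ℝ) ≃L[ℝ] (Fin n₁ → ℂ))
  (hΦ₁ : ∀ v i, Φ₁ v i = (v (Sum.inl i) : ℂ) + ∑ j, Ω₁ i j * (v (Sum.inr j) : ℂ))
  (hΩ₂ : ∀ i j, Ω₂ i j = Ω₂ j i) (hpos₂ : (Matrix.of fun i j => (Ω₂ i j).im).PosDef)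
  (Φ₂ : (Fin n₂ ⊕ Fin n₂ → ℝ) ≃L[ℝ] (Fin n₂ → ℂ))
  (hΦ₂ : ∀ v i, Φ₂ v i = (v (Sum.inl i) : ℂ) + ∑ j, Ω₂ i j * (v (Sum.inr j) : ℂ))

include hΩb hΦ hΦ₁ in
/-- **The period isomorphism splits, first factor**: `Φ(a)ᵢ = Φ₁(a|₁)ᵢ` for `i < n₁`, where
`a|₁ = a ∘ Sum.map castAdd castAdd` are the lattice coordinates of the first factor (the `(1,2)` block of
`Ω₁ ⊕ Ω₂` vanishes). [cite: GrushevskyXie2025, Remark 6.2 (p0034)] -/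
theorem apply_castAdd_eq (a : Fin (n₁ + n₂) ⊕ Fin (n₁ + n₂) → ℝ) (i : Fin n₁) :
    Φ a (Fin.castAdd n₂ i) = Φ₁ (a ∘ Sum.map (Fin.castAdd n₂) (Fin.castAdd n₂)) i := by
  subst hΩb
  rw [hΦ, hΦ₁, Fin.sum_univ_add]
  simp

include hΩb hΦ hΦ₂ in
/-- **The period isomorphism splits, second factor**: `Φ(a)_{n₁+i} = Φ₂(a|₂)ᵢ`,
`a|₂ = a ∘ Sum.map natAdd natAdd`. [cite: GrushevskyXie2025, Remark 6.2 (p0034)] -/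
theorem apply_natAdd_eq (a : Fin (n₁ + n₂) ⊕ Fin (n₁ + n₂) → ℝ) (i : Fin n₂) :
    Φ a (Fin.natAdd n₁ i) = Φ₂ (a ∘ Sum.map (Fin.natAdd n₁) (Fin.natAdd n₁)) i := by
  subst hΩb
  rw [hΦ, hΦ₂, Fin.sum_univ_add]
  simp

include hΩb hΦ hΦ₁ in
/-- **The first projection commutes with the coverings**: `p₁(π(v)) = π₁(v|_{ℂ^{n₁}})`, i.e.
`(cover Φ v)|₁ = cover Φ₁ (v ∘ castAdd)`. [cite: GrushevskyXie2025, Remark 6.2 (p0034)] -/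
theorem cover_restrict_fst (v : Fin (n₁ + n₂) → ℂ) :
    (fun j ↦ cover Φ v (Sum.map (Fin.castAdd n₂) (Fin.castAdd n₂) j)) =
      cover Φ₁ (fun i ↦ v (Fin.castAdd n₂ i)) := by
  obtain ⟨a, rfl⟩ : ∃ a, v = Φ a := ⟨Φ.symm v, (Φ.apply_symm_apply v).symm⟩
  have h1 : (fun i ↦ Φ a (Fin.castAdd n₂ i)) = Φ₁ (a ∘ Sum.map (Fin.castAdd n₂) (Fin.castAdd n₂)) :=
    funext (apply_castAdd_eq Ω₁ Ω₂ hΩb Φ hΦ Φ₁ hΦ₁ a)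
  rw [h1, cover_apply_apply, cover_apply_apply]
  rfl

include hΩb hΦ hΦ₂ in
/-- **The second projection commutes with the coverings**: `(cover Φ v)|₂ = cover Φ₂ (v ∘ natAdd)`.
[cite: GrushevskyXie2025, Remark 6.2 (p0034)] -/
theorem cover_restrict_snd (v : Fin (n₁ + n₂) → ℂ) :
    (fun j ↦ cover Φ v (Sum.map (Fin.natAdd n₁) (Fin.natAdd n₁) j)) =
      cover Φ₂ (fun i ↦ v (Fin.natAdd n₁ i)) := by
  obtain ⟨a, rfl⟩ : ∃ a, v = Φ a := ⟨Φ.symm v, (Φ.apply_symm_apply v).symm⟩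
  have h1 : (fun i ↦ Φ a (Fin.natAdd n₁ i)) = Φ₂ (a ∘ Sum.map (Fin.natAdd n₁) (Fin.natAdd n₁)) :=
    funext (apply_natAdd_eq Ω₁ Ω₂ hΩb Φ hΦ Φ₂ hΦ₂ a)
  rw [h1, cover_apply_apply, cover_apply_apply]
  rfl

include hΩb hpos₁ hpos₂ hΦ₁ hΦ₂ in
/-- **The theta divisor of a product of principally polarised abelian varieties:
`Θ = p₁⁻¹(Θ₁) ∪ p₂⁻¹(Θ₂) = (Θ₁ × X₂) ∪ (X₁ × Θ₂)`.** For `Ω = Ω₁ ⊕ Ω₂` the theta divisor of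
`X_Ω = X_{Ω₁} × X_{Ω₂}` consists of the points whose first projection (`mapMatrix` of the coordinate
projection `P₁`) lies on `Θ₁` or whose second projection lies on `Θ₂` — "if `(A, Θ) = (A′, Θ′) × (A″, Θ″)`,
then the theta divisor `Θ = (Θ′ × A″) ∪ (A′ × Θ″)` is reducible". Proof: `π(v) ∈ Θ ↔ ϑ(v, Ω) = 0 ↔
ϑ(v₁, Ω₁) ϑ(v₂, Ω₂) = 0` (`riemannTheta_blockDiag`) and `pᵢ ∘ π = πᵢ ∘ prᵢ`.
[cite: GrushevskyXie2025, Remark 6.2 (p0034)] [cite: Lange2023AbelianVarietiesComplex, §2.1.2 (p0079)] -/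
theorem thetaDivisor_blockDiag_eq_union :
    thetaDivisor Ω hΩ hpos Φ hΦ =
      {x | mapMatrix Φ Φ₁ ((1 : Matrix _ _ ℤ).submatrix (Sum.map (Fin.castAdd n₂) (Fin.castAdd n₂)) id) x ∈
          thetaDivisor Ω₁ hΩ₁ hpos₁ Φ₁ hΦ₁} ∪
      {x | mapMatrix Φ Φ₂ ((1 : Matrix _ _ ℤ).submatrix (Sum.map (Fin.natAdd n₁) (Fin.natAdd n₁)) id) x ∈
          thetaDivisor Ω₂ hΩ₂ hpos₂ Φ₂ hΦ₂} := by
  ext x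
  obtain ⟨v, rfl⟩ := cover_surjective Φ x
  rw [Set.mem_union, Set.mem_setOf_eq, Set.mem_setOf_eq, mapMatrix_submatrix_one,
    mapMatrix_submatrix_one, cover_restrict_fst Ω₁ Ω₂ hΩb Φ hΦ Φ₁ hΦ₁,
    cover_restrict_snd Ω₁ Ω₂ hΩb Φ hΦ Φ₂ hΦ₂, cover_mem_thetaDivisor_iff, cover_mem_thetaDivisor_iff,
    cover_mem_thetaDivisor_iff]
  exact riemannTheta_blockDiag_eq_zero_iff_of_posDef hΩb hpos₁ hpos₂ v

include hΩb hpos₁ hΦ₁ hΩ₂ hpos₂ Φ₂ hΦ₂ in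
/-- **The component `Θ₁ × X₂ ⊆ Θ`**: `p₁⁻¹(Θ₁) ⊆ Θ` (the second factor's data `Φ₂` enters only the
proof). [cite: GrushevskyXie2025, Remark 6.2 (p0034)] -/
theorem preimage_fst_subset_thetaDivisor :
    {x | mapMatrix Φ Φ₁ ((1 : Matrix _ _ ℤ).submatrix (Sum.map (Fin.castAdd n₂) (Fin.castAdd n₂)) id) x ∈
        thetaDivisor Ω₁ hΩ₁ hpos₁ Φ₁ hΦ₁} ⊆ thetaDivisor Ω hΩ hpos Φ hΦ := by
  rw [thetaDivisor_blockDiag_eq_union Ω₁ Ω₂ hΩb hΩ hpos Φ hΦ hΩ₁ hpos₁ Φ₁ hΦ₁ hΩ₂ hpos₂ Φ₂ hΦ₂]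
  exact Set.subset_union_left

include hΩb hΩ₁ hpos₁ Φ₁ hΦ₁ hpos₂ hΦ₂ in
/-- **The component `X₁ × Θ₂ ⊆ Θ`**: `p₂⁻¹(Θ₂) ⊆ Θ` (the first factor's data `Φ₁` enters only the
proof). [cite: GrushevskyXie2025, Remark 6.2 (p0034)] -/
theorem preimage_snd_subset_thetaDivisor :
    {x | mapMatrix Φ Φ₂ ((1 : Matrix _ _ ℤ).submatrix (Sum.map (Fin.natAdd n₁) (Fin.natAdd n₁)) id) x ∈
        thetaDivisor Ω₂ hΩ₂ hpos₂ Φ₂ hΦ₂} ⊆ thetaDivisor Ω hΩ hpos Φ hΦ := by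
  rw [thetaDivisor_blockDiag_eq_union Ω₁ Ω₂ hΩb hΩ hpos Φ hΦ hΩ₁ hpos₁ Φ₁ hΦ₁ hΩ₂ hpos₂ Φ₂ hΦ₂]
  exact Set.subset_union_right

include hΩb hpos₁ hpos₂ hΦ hΦ₁ hΦ₂ in
/-- **`Θ₁ × Θ₂ ⊆ Sing Θ`.** If both projections of `π(v)` lie on the theta divisors of the factors, then
the defining equation `ϑ(·, Ω)` of `Θ` on the universal cover (`π^*Θ = (ϑ)`, `cover_preimage_thetaDivisor`)
vanishes at `v` together with its differential — `π(v)` is a point of multiplicity `≥ 2` of `Θ`: "the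
singular locus of the theta divisor `Sing Θ` contains a `(g − 2)`-dimensional subvariety `Θ′ × Θ″`".
[cite: GrushevskyXie2025, Remark 6.2 (p0034)] -/
theorem hasFDerivAt_riemannTheta_zero_of_mem_inter (v : Fin (n₁ + n₂) → ℂ)
    (h₁ : mapMatrix Φ Φ₁ ((1 : Matrix _ _ ℤ).submatrix (Sum.map (Fin.castAdd n₂) (Fin.castAdd n₂)) id)
        (cover Φ v) ∈ thetaDivisor Ω₁ hΩ₁ hpos₁ Φ₁ hΦ₁)
    (h₂ : mapMatrix Φ Φ₂ ((1 : Matrix _ _ ℤ).submatrix (Sum.map (Fin.natAdd n₁) (Fin.natAdd n₁)) id)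
        (cover Φ v) ∈ thetaDivisor Ω₂ hΩ₂ hpos₂ Φ₂ hΦ₂) :
    riemannTheta Ω v = 0 ∧ HasFDerivAt (riemannTheta Ω) (0 : (Fin (n₁ + n₂) → ℂ) →L[ℂ] ℂ) v := by
  rw [mapMatrix_submatrix_one, cover_restrict_fst Ω₁ Ω₂ hΩb Φ hΦ Φ₁ hΦ₁, cover_mem_thetaDivisor_iff] at h₁
  rw [mapMatrix_submatrix_one, cover_restrict_snd Ω₁ Ω₂ hΩb Φ hΦ Φ₂ hΦ₂, cover_mem_thetaDivisor_iff] at h₂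
  exact hasFDerivAt_riemannTheta_blockDiag_zero_of_posDef hΩb hpos₁ hpos₂ v h₁ h₂

include hΩb hpos₁ hpos₂ hΦ hΦ₁ hΦ₂ in
/-- `Θ₁ × Θ₂ ⊆ Θ` (the intersection of the two components).
[cite: GrushevskyXie2025, Remark 6.2 (p0034)] -/
theorem cover_mem_thetaDivisor_of_mem_inter (v : Fin (n₁ + n₂) → ℂ)
    (h₁ : mapMatrix Φ Φ₁ ((1 : Matrix _ _ ℤ).submatrix (Sum.map (Fin.castAdd n₂) (Fin.castAdd n₂)) id)
        (cover Φ v) ∈ thetaDivisor Ω₁ hΩ₁ hpos₁ Φ₁ hΦ₁)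
    (h₂ : mapMatrix Φ Φ₂ ((1 : Matrix _ _ ℤ).submatrix (Sum.map (Fin.natAdd n₁) (Fin.natAdd n₁)) id)
        (cover Φ v) ∈ thetaDivisor Ω₂ hΩ₂ hpos₂ Φ₂ hΦ₂) :
    cover Φ v ∈ thetaDivisor Ω hΩ hpos Φ hΦ :=
  (cover_mem_thetaDivisor_iff Ω hΩ hpos Φ hΦ v).mpr
    (hasFDerivAt_riemannTheta_zero_of_mem_inter Ω₁ Ω₂ hΩb Φ hΦ hΩ₁ hpos₁ Φ₁ hΦ₁ hΩ₂ hpos₂ Φ₂ hΦ₂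
      v h₁ h₂).1

end Product

end ComplexTorus

end Literature.Geometry.Kaehler

end
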